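import Summits.NavierStokesRegularity.NavierStokesRegularity.Theorems.QuantisedSymmetryPolyhedralDssProfileExistsStubSmoothRepresentativeAe
import Summits.NavierStokesRegularity.NavierStokesRegularity.Theorems.QuantisedSymmetryPolyhedralDssProfileExistsStubTransportAe
import Summits.NavierStokesRegularity.NavierStokesRegularity.Theorems.QuantisedSymmetryPolyhedralDssProfileExistsStubClassicalOfOseenMildPast
import Summits.NavierStokesRegularity.NavierStokesRegularity.Theorems.QuantisedSymmetryPolyhedralDssProfileExistsStubSliceNonzero
import Summits.NavierStokesRegularity.NavierStokesRegularity.Theorems.QuantisedSymmetryPolyhedralDssProfileExistsStubNoLargeScaleNullSlice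
import Summits.NavierStokesRegularity.NavierStokesRegularity.Theorems.QuantisedSymmetryPolyhedralDssProfileExistsStubBlowupTrace
import Summits.NavierStokesRegularity.NavierStokesRegularity.Theorems.QuantisedSymmetryPolyhedralDssProfileExistsStubNoWeakHealing
import Summits.NavierStokesRegularity.NavierStokesRegularity.Theorems.QuantisedSymmetryPolyhedralDssProfileExistsStubAncientDuhamel
import Summits.NavierStokesRegularity.NavierStokesRegularity.Theorems.QuantisedSymmetryPolyhedralDssProfileExistsStubTraceWeakLimit
import Summits.NavierStokesRegularity.NavierStokesRegularity.Theorems.QuantisedSymmetryPolyhedralDssProfileExistsStubZoomLimitIsTrace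
import HarnessLib

/-!
# The portrait of a witness, III — its SCAR — crux stmt-NavierStokesRegularity-1404
  (`QuantisedSymmetry.PolyhedralDssProfileExists`), line polyhedral_cell, stub stub_witnessPortraitIII (N24, lead c17)

Registered assembly stub `stub_witnessPortraitIII` (`--supports stmt-NavierStokesRegularity-1404`). Every witness
`(G, c, u, C₀)` of the crux `QuantisedSymmetry.PolyhedralDssProfileExists` (an ancient mild solution of 3-D
Navier–Stokes with measurable slices, exactly `c`-DSS, Type-I bounded, `G`-equivariant, not a.e. zero — finiteness,
determinant and irreducibility of `G` are not needed) admits an Oseen-gauge representative `V` (A1 `stub_smoothRepresentative_ae`,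
A2 `stub_transport_ae`, classical pressure `exists_isClassicalNSSolutionOn_Iio_of_isTypeIAncientMild`) whose
**blow-up-time trace** `V₀ = lim_{t ↑ 0} V(t, ·)` (N18 `stub_blowupTrace`) is continuous off the origin, bounded by
`C₀/|x|`, `c`-DSS-homogeneous of degree `−1`, `G`-equivariant, locally integrable, weakly divergence free, is the weak
limit of the slices (N25 `stub_traceWeakLimit`) and is **not identically zero**; the slices do not tend weakly to zero
(N19 `stub_noWeakHealing`), no slice is null at large scales (N17 `stub_noLargeScaleNullSlice` with N4
`stub_sliceNonzero`), along the DSS scales the large-scale limit of every slice is `V₀` (N27 `stub_zoomLimitIsTrace`),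
and `V` is minus its own Duhamel integral from `−∞` (N21 `stub_ancientDuhamel`). In words: a Type-I DSS singularity
cannot heal — it leaves a nonzero, log-periodically homogeneous, polyhedrally symmetric, solenoidal `|x|⁻¹`-scar at the
blow-up time, and that scar is what every slice looks like at large scales.
-/

noncomputable section

-- the summit namespace `…NavierStokesRegularity.NavierStokesRegularity…` is the tree convention (D-0017)
set_option linter.dupNamespace false

namespace Summit.NavierStokesRegularity.NavierStokesRegularity.Theorems.PolyhedralDssProfileExists.PolyhedralCell

open MeasureTheory Set Function Filter Topology
open Literature.Analysis Literature.Analysis.FluidPDE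
open scoped InnerProductSpace RealInnerProductSpace

/-- **The portrait of a witness, III — its scar (registered assembly stub N24, lead c17).** See the module
docstring: representative `V` with classical pressure, trace `V₀` with its structural properties, `V₀ ≢ 0`, no weak
healing, no large-scale-null slice, zoom limits along the DSS scales equal `V₀`, and the ancient Duhamel form.
Assembly of A1 (p156260), A2 (p155960), p152134, N4 (p159754), N17 (p167789), N18 (p168727), N19 (p167727),
N21 (p167665), N25 (p169263), N27 (p169227). [sources: the cited stubs; folklore] -/
theorem stub_witnessPortraitIII :
    ∀ (G : Subgroup (EuclideanSpace ℝ (Fin 3) ≃ₗᵢ[ℝ] EuclideanSpace ℝ (Fin 3))) (c : ℝ)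
      (u : ℝ → EuclideanSpace ℝ (Fin 3) → EuclideanSpace ℝ (Fin 3)) (C₀ : ℝ),
      1 < c → IsAncientMildSolution 1 u → (∀ t < 0, AEStronglyMeasurable (u t) volume) →
      IsDiscretelySelfSimilar c u → HasTypeIDecay C₀ u → (∀ g ∈ G, ∀ t x, u t (g x) = g (u t x)) →
      ¬ (∀ t < 0, u t =ᵐ[volume] 0) →
      ∃ (V : ℝ → EuclideanSpace ℝ (Fin 3) → EuclideanSpace ℝ (Fin 3)) (C : ℝ)
        (p : ℝ → EuclideanSpace ℝ (Fin 3) → ℝ) (V₀ : EuclideanSpace ℝ (Fin 3) → EuclideanSpace ℝ (Fin 3)),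
        IsTypeIAncientMild C V ∧ HasTypeIDecay C₀ V ∧ (∀ t < 0, V t =ᵐ[volume] u t) ∧
        IsDiscretelySelfSimilar c V ∧ (∀ g ∈ G, ∀ t x, V t (g x) = g (V t x)) ∧
        IsClassicalNSSolutionOn (Set.Iio 0) 1 0 V p ∧
        V₀ 0 = 0 ∧ ContinuousOn V₀ {x | x ≠ 0} ∧
        (∀ x, x ≠ 0 → Tendsto (fun t => V t x) (𝓝[<] 0) (𝓝 (V₀ x))) ∧
        (∀ x, ‖x‖ * ‖V₀ x‖ ≤ C₀) ∧ (∀ x, V₀ (c • x) = c⁻¹ • V₀ x) ∧ (∀ g ∈ G, ∀ x, V₀ (g x) = g (V₀ x)) ∧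
        LocallyIntegrable V₀ volume ∧ IsWeaklyDivFree V₀ ∧
        (∀ φ : EuclideanSpace ℝ (Fin 3) → EuclideanSpace ℝ (Fin 3), Continuous φ → HasCompactSupport φ →
          Tendsto (fun t => ∫ x, ⟪V t x, φ x⟫_ℝ) (𝓝[<] 0) (𝓝 (∫ x, ⟪V₀ x, φ x⟫_ℝ))) ∧
        (∃ x, V₀ x ≠ 0) ∧
        ¬ (∀ φ : EuclideanSpace ℝ (Fin 3) → EuclideanSpace ℝ (Fin 3),
            Literature.Analysis.FunctionSpaces.IsTestFunctionOn
              (⊤ : TopologicalSpace.Opens (EuclideanSpace ℝ (Fin 3))) φ →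
            Tendsto (fun t => ∫ x, ⟪V t x, φ x⟫_ℝ) (𝓝[<] 0) (𝓝 0)) ∧
        (∀ t₀ < 0, ¬ (∀ φ : EuclideanSpace ℝ (Fin 3) → EuclideanSpace ℝ (Fin 3),
            Literature.Analysis.FunctionSpaces.IsTestFunctionOn
              (⊤ : TopologicalSpace.Opens (EuclideanSpace ℝ (Fin 3))) φ →
            Tendsto (fun lam : ℝ => ∫ x, ⟪lam • V t₀ (lam • x), φ x⟫_ℝ) atTop (𝓝 0))) ∧
        (∀ t₀ < 0, ∀ φ : EuclideanSpace ℝ (Fin 3) → EuclideanSpace ℝ (Fin 3), Continuous φ → HasCompactSupport φ →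
          Tendsto (fun k : ℕ => ∫ x, ⟪(c ^ k) • V t₀ ((c ^ k) • x), φ x⟫_ℝ) atTop (𝓝 (∫ x, ⟪V₀ x, φ x⟫_ℝ))) ∧
        (∀ t < 0, ∀ x, Tendsto (fun s => oseenDuhamel 1 s V V t x) atBot (𝓝 (-(V t x)))) := by
  intro G c u C₀ hc hanc hmeas hdss hdec hequ hnt
  -- ## the Oseen-gauge representative, its self-similarity/equivariance, its classical pressure
  obtain ⟨V, C, hV, hVdec, hae, hzero⟩ := stub_smoothRepresentative_ae u C₀ hanc hmeas hdec
  obtain ⟨hVdss, hVequ⟩ := stub_transport_ae G c u V C hc hdss hequ hV hae hzero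
  obtain ⟨p, hcl⟩ := exists_isClassicalNSSolutionOn_Iio_of_isTypeIAncientMild hV
  -- ## the trace and its weak-limit properties
  obtain ⟨V₀, hV00, hV0cont, hV0lim, hV0bd, hV0hom, hV0equ⟩ := stub_blowupTrace V C C₀ hV hVdec
  obtain ⟨hV0loc, hV0div, hV0weak⟩ := stub_traceWeakLimit V C C₀ V₀ hV hVdec hV0lim
  -- ## every negative slice of `u` is nontrivial (N4)
  have hslice : ∀ t < 0, ¬ (u t =ᵐ[volume] 0) := fun t ht h =>
    hnt (stub_sliceNonzero c u C₀ hc hanc hmeas hdss hdec ⟨t, ht, h⟩)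
  -- ## no weak healing (N19)
  have hnoheal : ¬ (∀ φ : EuclideanSpace ℝ (Fin 3) → EuclideanSpace ℝ (Fin 3),
      Literature.Analysis.FunctionSpaces.IsTestFunctionOn
        (⊤ : TopologicalSpace.Opens (EuclideanSpace ℝ (Fin 3))) φ →
      Tendsto (fun t => ∫ x, ⟪V t x, φ x⟫_ℝ) (𝓝[<] 0) (𝓝 0)) := by
    intro h
    have hV0' := stub_noWeakHealing V p C₀ hcl hVdec h
    refine hslice (-1) (by norm_num) ?_
    have h1 : V (-1) =ᵐ[volume] (0 : EuclideanSpace ℝ (Fin 3) → EuclideanSpace ℝ (Fin 3)) :=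
      ae_of_all _ (fun x => hV0' (-1) (by norm_num) x)
    exact ((hae (-1) (by norm_num)).symm).trans h1
  -- ## the trace is not identically zero
  have hV0ne : ∃ x, V₀ x ≠ 0 := by
    by_contra h
    simp only [not_exists, not_not] at h
    apply hnoheal
    intro φ hφ
    have hw := hV0weak φ hφ.contDiff.continuous hφ.hasCompactSupport
    simpa [h] using hw
  -- ## no slice is null at large scales (N17 on `V`, then N4)
  have hnonull : ∀ t₀ < 0, ¬ (∀ φ : EuclideanSpace ℝ (Fin 3) → EuclideanSpace ℝ (Fin 3),
      Literature.Analysis.FunctionSpaces.IsTestFunctionOn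
        (⊤ : TopologicalSpace.Opens (EuclideanSpace ℝ (Fin 3))) φ →
      Tendsto (fun lam : ℝ => ∫ x, ⟪lam • V t₀ (lam • x), φ x⟫_ℝ) atTop (𝓝 0)) := by
    intro t₀ ht₀ h
    have h0 := stub_noLargeScaleNullSlice V C₀ hV.isAncientMildSolution
      (fun t ht => hV.aestronglyMeasurable_slice ht) hVdec t₀ ht₀ h t₀ le_rfl
    exact hslice t₀ ht₀ (((hae t₀ ht₀).symm).trans h0)
  -- ## zoom limits along the DSS scales (N27) and the ancient Duhamel form (N21)
  have hzoom := stub_zoomLimitIsTrace V c V₀ hc hVdss hV0weak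
  have hduh := (stub_ancientDuhamel V C hV).2
  refine ⟨V, C, p, V₀, hV, hVdec, hae, hVdss, hVequ, hcl, hV00, hV0cont, hV0lim, hV0bd, hV0hom c hc hVdss,
    fun g hg => hV0equ g (hVequ g hg), hV0loc, hV0div, hV0weak, hV0ne, hnoheal, hnonull, hzoom, hduh⟩

end Summit.NavierStokesRegularity.NavierStokesRegularity.Theorems.PolyhedralDssProfileExists.PolyhedralCell

end
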